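/-
Copyright (c) 2026 the pub-hodgecm-mathlib formalisation cell (harness21).  Prover seat hodgecm-mathlib-LH7-p05 (g0), req620 Track A «(D-RAM) FOUR-FRAME» squad, helper lane on
h413 = stmt-HodgeConjecture-24833 (count-neutral).  β-BOARD row R8-EQ-a «THE LOCUS STRATUM ON THE EQUILATERAL KEY» (β chair F0P3a-p01 (g37) LEDGER #17∕#19 (iii)), FILE EQ-3.  2026-09-04.
-/
import Summits.HodgeConjecture.HodgeConjecture.Theorems.F0P3cDyRamLabelledOddCoreHangingWindowCut       -- ★ p862275 EQ-2c (this seat): the orbit sum; brings ★ EQ-2a∕2b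
import Summits.HodgeConjecture.HodgeConjecture.Theorems.F0P3cDyRamLabelledOddCoreHangingLocusCut        -- EQ-3a p862315 (this seat): `shell_latt_coreHanging_rep_iff_locus_of_near`
import Summits.HodgeConjecture.HodgeConjecture.Theorems.F0P3cDyRamGlueWindowVanishingLocus           -- ★ p862310 (LH7-p07 (g0)): the three LOCUS sums `sum_filter_sum_normSign_*_eq_zero_locus`
import Summits.HodgeConjecture.HodgeConjecture.Theorems.F0P3cDyRamDiagonalCoreHangingGlueCount         -- ★ (D2) (LH4-p07): `pairwise_disjoint_orbits_of`; brings ★ (C) `coreHangingStratum_eq_iUnion_orbits`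
import Summits.HodgeConjecture.HodgeConjecture.Theorems.F0P3cDyRamDiagonalKappaCoreHangingSocket      -- ★ κH-B2 (LH4-p06): `finite_orbit`, `v_glueUnit_letters`
import Summits.HodgeConjecture.HodgeConjecture.Theorems.F0P3cDyRamTowerSignTokenSharp               -- ★ p861295 (LH7-p07 (g0)): `exists_towerSign_prec_abs_of_le`
import Summits.HodgeConjecture.HodgeConjecture.Theorems.F0P3cDyRamLabelledOddGlueWindowSigns          -- ★ p861824 (this seat): `exists_normClass_system`
import Summits.HodgeConjecture.HodgeConjecture.Theorems.F0P3cDyRamLabelledOddPureStrataG1           -- ★ p860827: DEFS of record (`mcOfRecord`, `mstarOfRecord`)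
import HarnessLib

/-!
# Crux `H413`, line LH4 «(D-RAM) FOUR-FRAME» — (β) table, β-BOARD row R8-EQ-a, FILE EQ-3: ON THE EQUILATERAL KEY `n₁ = n₂ = n₃ = m`, AT THE LOCUS `2ρ + ℓ₀ = m` (`2ρ + mc ≤ 2m`),
# THE CLEAN-SHELL CUT OF THE CORE-HANGING STRATUM `H(ρ) = (2ρ, 2ρ, 2ρ)` CARRIES LABELLED ODD VALUE `0` — `Σᶠ_{M ∈ H(ρ) ∩ shell} lOC_i(M) ∕ [𝒰 : N(S̃′(M))] = 0`

Cell `hodgecm-mathlib` (D-0151), FLOOR 0, crux item H413 = `stmt-HodgeConjecture-24833`, route `HCCMUnconditional`; squad F0∕P3c∕LH4 (β-table fan; β chair F0P3a-p01 (g37), H-line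
junction LH4-p05 (g9)).  THEOREMS ONLY (no `def`, no instance, no notation, no `sorry`, default heartbeats); ★-only imports; lane `--supports stmt-HodgeConjecture-24833 --as helper`
(count-neutral); pays NO row, states NO law.  Consumer: the `hEqW` binder of LH4-p05 (g9)'s H-line junction ★ p862088 `equilateral_zero_of_window` (its equality half
`2ρ + d % 2 = n₂`; the strict half is this seat's EQ-2d `…CoreHangingEquilateralWindow`), i.e. the (EQW) schema of the β chair's `hRest_of_heads` (LEDGER #20).  Binders in ★ p861362's
COMMON SHAPE for the H axis; class `[CompleteSpace K] [Fintype 𝓀[K]]`.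

THE PROOF (the R7 mechanism at `t′ = 0`, `E = 0`).  ★ B7 `stratum_H_eq`; at the locus the stratum is in the TUBE regime (`m ≥ 2ρ`), so ★ B7 (iv)(C) `coreHangingStratum_eq_iUnion_orbits`
writes it as the disjoint union of the unit-torus orbits of the ADMISSIBLE representatives `latt V_H(1,1,g)`, `g ∈ R`, `|1 + g| = 1` (★ (iv-c)'s fixed-unit system), every one of them
`T`-stable (★ `mapGL_latt_glued_rep_of_depths`); the clean shell is torus-invariant, so the cut is the union of the orbits with `g` in EQ-3a's GENERIC class `|g + c₀| = 1` (`c₀ = g_β∕g_α`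
the ratio of LH7-p07's sharp tokens ★ p861295 at the common depth `m`, `|c₀ − g₀| ≤ |ϖ|`); ★ EQ-2c's orbit sum evaluates each orbit as `mass · ω(D_i)∕(2·#Aβ·#Aγ)·ΣΣ`, ★ EQ-2a
`classSign_mul_labelSign_eq_unit` AT `E = 0` rewrites `ω(D_i)·ΣΣ = #Aγ·ω(g_α)·Σ_{aβ} G_i(g + (1+g)(aβ−1))`, and LH7-p07's LOCUS sums `sum_filter_sum_normSign_{mul_add, add,
one_add_mul_add}_eq_zero_locus` (filter `|1 + g| = 1 ∧ |g + c₀| = 1`) kill `Σ_g Σ_{aβ} G_i`.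
HONEST LABEL: count-neutral; with ★ p862023 and EQ-2d this closes the (EQW) schema; hH ∕ hRest ∕ (β-BAL) ∕ (β) ∕ T₊ OPEN; `HC_CM` is proved only modulo the 7 printed citations
(2 remaining named inputs: hLiu418 = `stmt-HodgeConjecture-24832`, h413 = `stmt-HodgeConjecture-24833`) until rung 0 closes.
References: [Kottwitz1986BaseChangeUnits] §1 pp. 240–241 · [Rogawski1990] §4.9 Prop. 4.9.1 (a)(b) p. 55, §4.10 p. 58 · [LanglandsShelstad1987] §3 · [Serre1979] Ch. V §3, Ch. XV §2 ·
[Serre1980Trees] Ch. II §1.1.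
-/

set_option autoImplicit false

noncomputable section

namespace Summit.HodgeConjecture.HodgeConjecture.Cruxes.H413.F0P3cDyRamLabelledOddCoreHangingEquilateralLocus

open Matrix WithZero
open Literature.NumberTheory.Automorphic Literature.NumberTheory.Automorphic.HermitianLattice Literature.NumberTheory.Automorphic.UnitaryGroup
open Literature.NumberTheory.Automorphic.UnitaryLatticeTree Literature.NumberTheory.Automorphic.UnitaryThreeFourFrame
open Literature.NumberTheory.LocalFields Literature.NumberTheory.LocalFields.WildQuadraticDatum
open Summit.HodgeConjecture.HodgeConjecture.Cruxes.H413.F0P3cDyRamFourFramePieces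
open Summit.HodgeConjecture.HodgeConjecture.Cruxes.H413.F0P3cDyRamFourFrameCensusDefs
open Summit.HodgeConjecture.HodgeConjecture.Cruxes.H413.F0P3cDyRamStageOneBDefs (mcOfRecord)
open Summit.HodgeConjecture.HodgeConjecture.Cruxes.H413.F0P3cDyRamDiagonalTorusDefs
open Summit.HodgeConjecture.HodgeConjecture.Cruxes.H413.F0P3cDyRamDiagonalStrataDefs
open Summit.HodgeConjecture.HodgeConjecture.Cruxes.H413.F0P3cDyRamLabelledOddCountDefs
open Summit.HodgeConjecture.HodgeConjecture.Cruxes.H413.F0P3cDyRamDiagonalCoreHangingSocket (stratum_H_eq)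
open Summit.HodgeConjecture.HodgeConjecture.Cruxes.H413.F0P3cDyRamDiagonalGluedClassRepresentatives (exists_fixed_class_representatives v_mul_map_pow map_mul_map_eq)
open Summit.HodgeConjecture.HodgeConjecture.Cruxes.H413.F0P3cDyRamDiagonalGluedTorusOrbits (exists_gl_coe_eq_glued)
open Summit.HodgeConjecture.HodgeConjecture.Cruxes.H413.F0P3cDyRamDiagonalKappaGluedDecomposition (mapGL_latt_glued_rep_of_depths)
open Summit.HodgeConjecture.HodgeConjecture.Cruxes.H413.F0P3cDyRamDiagonalCoreHangingCount (coreHangingStratum_eq_iUnion_orbits)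
open Summit.HodgeConjecture.HodgeConjecture.Cruxes.H413.F0P3cDyRamDiagonalCoreHangingGlueCount (pairwise_disjoint_orbits_of)
open Summit.HodgeConjecture.HodgeConjecture.Cruxes.H413.F0P3cDyRamDiagonalKappaCoreHangingSocket (finite_orbit v_glueUnit_letters)
open Summit.HodgeConjecture.HodgeConjecture.Cruxes.H413.F0P3cDyRamLevelCountDiagonalModel (latticeInLevel_diagonal_mapGL_iff)
open Summit.HodgeConjecture.HodgeConjecture.Cruxes.H413.F0P3cDyRamTowerSignTokenSharp (exists_towerSign_prec_abs_of_le)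
open Summit.HodgeConjecture.HodgeConjecture.Cruxes.H413.F0P3cDyRamLabelledOddGlueWindowCut (v_div_sub_div_le v_add_eq_pow_iff_of_v_sub_le)
open Summit.HodgeConjecture.HodgeConjecture.Cruxes.H413.F0P3cDyRamLabelledOddGlueWindowSigns (exists_normClass_system)
open Summit.HodgeConjecture.HodgeConjecture.Cruxes.H413.F0P3cDyRamLabelledOddCoreHangingWindowSigns (classSign_mul_labelSign_eq_unit)
open Summit.HodgeConjecture.HodgeConjecture.Cruxes.H413.F0P3cDyRamLabelledOddCoreHangingWindowCut (finsum_orbit_labelledOdd_div_relIndex_coreHanging_rep_eq)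
open Summit.HodgeConjecture.HodgeConjecture.Cruxes.H413.F0P3cDyRamLabelledOddCoreHangingLocusCut (shell_latt_coreHanging_rep_iff_locus_of_near)
open Summit.HodgeConjecture.HodgeConjecture.Cruxes.H413.F0P3cDyRamGlueWindowVanishingLocus (sum_filter_sum_normSign_add_eq_zero_locus sum_filter_sum_normSign_mul_add_eq_zero_locus
  sum_filter_sum_normSign_one_add_mul_add_eq_zero_locus)
open scoped Valued WithZero Matrix MatrixGroups

variable {K : Type} [Field K] [Valued K ℤᵐ⁰] [CompleteSpace K] [Fintype 𝓀[K]] {σ : K →+* K} {ϖ : K} {d t : ℕ} {α β : K} {N₀ n₁ n₂ n₃ : ℕ}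

/-- **R8-EQ-a, THE LOCUS: `H(ρ)` CARRIES LABELLED ODD VALUE `0` ON THE EQUILATERAL KEY** (`n₁ = n₂ = n₃`, `2ρ + d % 2 = n₂`, `2ρ + mcOfRecord d ≤ 2·n₂`; non-empty cut = the generic
classes `|κ + g₀| = 1` of the admissible ones, value `0` by the sign cancellation of the linearised class sums at `t′ = 0`, `E = 0`).  With ★ p862023 and this seat's EQ-2d the β chair's
(EQW) schema is complete. [cite: Kottwitz1986BaseChangeUnits, §1 pp. 240–241] [cite: Rogawski1990, §4.9 Prop. 4.9.1 (a)(b) p. 55] [cite: LanglandsShelstad1987, §3] -/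
theorem finsum_stratum_H_shell_labelledOdd_div_relIndex_eq_zero_of_equilateral_locus (hD : IsRamifiedQuadraticDatum σ ϖ d t) (h2 : Valued.v (2 : K) < 1) (h2d : 2 ≤ d)
    (hE : IsElementDatum σ ϖ N₀ α β n₁ n₂ n₃) (hN₀ : d ≤ N₀) (hmc : mcOfRecord d ≤ N₀)
    (T : GL (Fin 3) K) (hT : (T : Matrix (Fin 3) (Fin 3) K) = Matrix.diagonal ![α, β, 1]) (ρ : ℕ) (hρ : 1 ≤ ρ)
    (h12 : n₁ = n₂) (h23 : n₂ = n₃) (hloc : 2 * ρ + d % 2 = n₂) (hhi : 2 * ρ + mcOfRecord d ≤ 2 * n₂) (i : Fin 3) :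
    ∑ᶠ M ∈ {M : Submodule 𝒪[K] (Fin 3 → K) | M ∈ stratum σ ϖ T ![2 * ρ, 2 * ρ, 2 * ρ] ∧
        (LatticeInLevel ϖ (d % 2) (Matrix.diagonal ![α - 1, β - 1, 0]) M ∧ ¬ LatticeInLevel ϖ (d % 2 + 1) (Matrix.diagonal ![α - 1, β - 1, 0]) M ∧
          LatticeInLevel ϖ (mcOfRecord d) (Matrix.diagonal ![(α - 1) * (α - 1), (β - 1) * (β - 1), 0]) M)},
      (labelledOddCount σ ϖ 0 i (valueClassLabel σ ϖ (α - 1) (β - 1) (mstarOfRecord d) d) M : ℚ) /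
        ((((unitStabilizer M).map (unitNormMap σ 3)).relIndex (fixedUnitTorus σ 3) : ℕ) : ℚ) = 0 := by
  classical
  obtain ⟨hσ, hvσ, hϖ, hfix, hd, -, -⟩ := id hD
  have hϖ0 : ϖ ≠ 0 := fun h0 => by rw [h0, map_zero] at hϖ; exact WithZero.coe_ne_zero hϖ.symm
  have hvϖ : Valued.v ϖ ≠ 0 := (Valuation.ne_zero_iff _).2 hϖ0
  have hϖ1 : Valued.v ϖ < 1 := by rw [hϖ, ← exp_zero, exp_lt_exp]; norm_num
  have hpw : ∀ a b : ℕ, Valued.v ϖ ^ a ≤ Valued.v ϖ ^ b ↔ b ≤ a := fun a b => by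
    rw [v_varpi_pow hϖ, v_varpi_pow hϖ, exp_le_exp]; omega
  have hpwlt : ∀ a b : ℕ, Valued.v ϖ ^ a < Valued.v ϖ ^ b ↔ b < a := fun a b => by
    rw [v_varpi_pow hϖ, v_varpi_pow hϖ, exp_lt_exp]; omega
  -- numerology of record
  have hmcdef : mcOfRecord d = 2 * ((d % 2 + 2 * d - 1 + d) / 2) := rfl
  have hmc2 : 2 * (d % 2) + 2 ≤ mcOfRecord d ∧ 3 * d ≤ mcOfRecord d + 2 ∧ mcOfRecord d ≤ 3 * d ∧ mstarOfRecord d = d % 2 + 2 * d - 1 :=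
    ⟨by omega, by omega, by omega, rfl⟩
  have hpar : n₂ % 2 = d % 2 := (F0P3cDyRamElementDatumParity.depth_mod_two_eq_of_isElementDatum hD hE hN₀).2.1
  have hn₂ : N₀ ≤ n₂ := hE.2.2.2.2.2.2.2.2.2.1
  have hEρ : 0 < ρ := by omega
  have hdeep : 2 * d - 1 + 0 ≤ 2 * ρ := by omega
  -- the element letters on the equilateral key
  have hα : Valued.v (α - 1) = Valued.v ϖ ^ n₂ := hE.2.2.2.2.2.2.1
  have hβ : Valued.v (β - 1) = Valued.v ϖ ^ n₂ := h12 ▸ hE.2.2.2.2.2.1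
  have hγ : Valued.v (β - α) = Valued.v ϖ ^ n₂ := by rw [show β - α = -(α - β) by ring, Valuation.map_neg, h23]; exact hE.2.2.2.2.2.2.2.1
  have hunit : ∀ {z : K}, z * σ z = 1 → Valued.v z = 1 := by
    intro z hz
    have h2' : Valued.v z ^ 2 = 1 := by
      have := congrArg Valued.v hz
      rwa [map_mul, hvσ, map_one, ← sq] at this
    exact (pow_eq_one_iff.1 h2').resolve_right (by norm_num)
  have hα1 : Valued.v α = 1 := hunit hE.1
  have hβ1 : Valued.v β = 1 := hunit hE.2.1
  obtain ⟨hg₀1, h1g₀⟩ := v_glueUnit_letters hϖ0 hβ hα hγ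
  have hTr := trace_bound_of_isRamifiedQuadraticDatum hD h2
  -- THE SHARP TOKENS AT THE COMMON DEPTH `n₂`, THE CENTRE `c₀ = g_β ∕ g_α`
  obtain ⟨-, gα, -, -, hσgα, -, hvgα, hαtok⟩ := exists_towerSign_prec_abs_of_le hD hE.1 hα hpar (by omega)
  obtain ⟨-, gβ, -, -, hσgβ, -, hvgβ, hβtok⟩ := exists_towerSign_prec_abs_of_le hD hE.2.1 hβ hpar (by omega)
  have hgα0 : gα ≠ 0 := fun h => by rw [h, map_zero] at hvgα; exact pow_ne_zero _ hvϖ hvgα.symm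
  have hc₀ : Valued.v (gβ / gα) = 1 := by rw [map_div₀, hvgα, hvgβ, div_self (pow_ne_zero _ hvϖ)]
  have hσc₀ : σ (gβ / gα) = gβ / gα := by rw [map_div₀, hσgα, hσgβ]
  have hnear : Valued.v (gβ / gα - (β - 1) / (α - 1)) ≤ Valued.v ϖ ^ 1 :=
    v_div_sub_div_le hϖ hα hvgα hvgβ hαtok hβtok (by omega) (by omega)
  have h1c₀ : Valued.v (1 - gβ / gα) = 1 := by
    rw [show 1 - gβ / gα = (1 - (β - 1) / (α - 1)) - (gβ / gα - (β - 1) / (α - 1)) by ring, Valuation.map_sub_eq_of_lt_left _ ?_, h1g₀]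
    rw [h1g₀]; exact hnear.trans_lt (pow_lt_one₀ zero_le hϖ1 (by omega))
  -- the ★ FILE 2b token letters
  have hP : Valued.v ((ϖ * σ ϖ) ^ ρ) = Valued.v ϖ ^ (2 * ρ) := v_mul_map_pow hvσ ϖ ρ
  have htok : ∀ {x e : K} {k : ℕ}, Valued.v (x - e) ≤ Valued.v ϖ ^ k → 2 * ρ + (d % 2 + 2 * d - 1) ≤ k →
      Valued.v ((ϖ ^ (d % 2 + 2 * d - 1))⁻¹ * (((ϖ * σ ϖ) ^ ρ)⁻¹ * (x - e))) ≤ 1 := by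
    intro x e k hxe hk
    rw [map_mul, map_inv₀, map_mul, map_inv₀, map_pow, hP, inv_mul_le_iff₀ (pow_pos ((Valuation.pos_iff _).2 hϖ0) _),
      inv_mul_le_iff₀ (pow_pos ((Valuation.pos_iff _).2 hϖ0) _), mul_one, ← pow_add]
    exact hxe.trans ((hpw _ _).2 hk)
  have hgαT := htok hαtok (by omega)
  have hgβT := htok hβtok (by omega)
  -- THE REPRESENTATIVES (fixed units modulo `𝔭^ρ`) AND THEIR FRAMES
  obtain ⟨R₀, hR₀fin, -, hR1, hR2, hR3⟩ := exists_fixed_class_representatives hσ hvσ hfix hϖ hd ρ 0 hρ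
  simp only [Nat.mul_zero, pow_zero, Nat.add_zero] at hR1 hR2 hR3
  set R : Finset K := hR₀fin.toFinset with hRdef
  have hmemR : ∀ g, g ∈ R ↔ g ∈ R₀ := fun g => Set.Finite.mem_toFinset hR₀fin
  have hR1' : ∀ g ∈ R, σ g = g ∧ Valued.v g = 1 := fun g hg => hR1 g ((hmemR g).1 hg)
  have hR2' : ∀ f : K, σ f = f → Valued.v f = 1 → ∃ g ∈ R, Valued.v (f - g) ≤ Valued.v ϖ ^ ρ :=
    fun f hσf hvf => by obtain ⟨g, hg, h⟩ := hR2 f hσf hvf; exact ⟨g, (hmemR g).2 hg, h⟩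
  have hR3' : ∀ g ∈ R, ∀ g' ∈ R, Valued.v (g - g') ≤ Valued.v ϖ ^ ρ → g = g' :=
    fun g hg g' hg' h => hR3 g ((hmemR g).1 hg) g' ((hmemR g').1 hg') h
  choose V₀ hV₀ using fun g : K => exists_gl_coe_eq_glued (1 : K) 1 g (pow_ne_zero ρ hϖ0) (pow_ne_zero (2 * ρ) hϖ0)
  -- THE CUT IN `g`-CURRENCY (locus: the generic class)
  have hiff := fun (g : K) (hg : g ∈ R) =>
    shell_latt_coreHanging_rep_iff_locus_of_near hD hE hρ h12 h23 hloc hhi (by rw [← pow_one (Valued.v ϖ)]; exact hnear) (hR1' g hg).2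
  set Rcut : Finset K := R.filter (fun g => Valued.v (1 + g) = 1 ∧ Valued.v (g + gβ / gα) = 1) with hRcut
  have h1g : ∀ g ∈ Rcut, Valued.v (1 + g) = 1 := fun g hg => (Finset.mem_filter.1 hg).2.1
  -- THE STRATUM AS A UNION OF ORBITS (tube regime: all admissible representatives), AND ITS CUT
  have h1n : Valued.v (β - 1) = Valued.v ϖ ^ n₁ := hE.2.2.2.2.2.1
  have h3n : Valued.v (β - α) = Valued.v ϖ ^ n₃ := by rw [show β - α = -(α - β) by ring, Valuation.map_neg]; exact hE.2.2.2.2.2.2.2.1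
  rw [stratum_H_eq hvσ hfix hϖ T hρ, coreHangingStratum_eq_iUnion_orbits hσ hvσ hϖ hTr T hT hα1 hβ1 h1n hα h3n hρ (by omega) (by omega) (by omega)
    (R := (R : Set K)) hR1' hR2']
  have hshellinv : ∀ u ∈ unitTorus K 3, ∀ M : Submodule 𝒪[K] (Fin 3 → K),
      (LatticeInLevel ϖ (d % 2) (Matrix.diagonal ![α - 1, β - 1, 0]) (mapGL (diagGLUnits u) M) ∧
          ¬ LatticeInLevel ϖ (d % 2 + 1) (Matrix.diagonal ![α - 1, β - 1, 0]) (mapGL (diagGLUnits u) M) ∧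
          LatticeInLevel ϖ (mcOfRecord d) (Matrix.diagonal ![(α - 1) * (α - 1), (β - 1) * (β - 1), 0]) (mapGL (diagGLUnits u) M)) ↔
        (LatticeInLevel ϖ (d % 2) (Matrix.diagonal ![α - 1, β - 1, 0]) M ∧ ¬ LatticeInLevel ϖ (d % 2 + 1) (Matrix.diagonal ![α - 1, β - 1, 0]) M ∧
          LatticeInLevel ϖ (mcOfRecord d) (Matrix.diagonal ![(α - 1) * (α - 1), (β - 1) * (β - 1), 0]) M) := by
    intro u _ M
    rw [latticeInLevel_diagonal_mapGL_iff (coe_diagGLUnits u), latticeInLevel_diagonal_mapGL_iff (coe_diagGLUnits u),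
      latticeInLevel_diagonal_mapGL_iff (coe_diagGLUnits u)]
  have hset : {M : Submodule 𝒪[K] (Fin 3 → K) | M ∈ (⋃ g ∈ {g : K | g ∈ (R : Set K) ∧ Valued.v (1 + g) = 1},
        {M : Submodule 𝒪[K] (Fin 3 → K) | ∃ u ∈ unitTorus K 3,
          M = mapGL (diagGLUnits u) (latt (!![1, 0, 0; 1, ϖ ^ ρ, 0; 1 * 1 + g, ϖ ^ ρ * 1, ϖ ^ (2 * ρ)] : Matrix (Fin 3) (Fin 3) K))}) ∧
        (LatticeInLevel ϖ (d % 2) (Matrix.diagonal ![α - 1, β - 1, 0]) M ∧ ¬ LatticeInLevel ϖ (d % 2 + 1) (Matrix.diagonal ![α - 1, β - 1, 0]) M ∧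
          LatticeInLevel ϖ (mcOfRecord d) (Matrix.diagonal ![(α - 1) * (α - 1), (β - 1) * (β - 1), 0]) M)} =
      ⋃ g ∈ (Rcut : Set K), {M : Submodule 𝒪[K] (Fin 3 → K) | ∃ u ∈ unitTorus K 3,
          M = mapGL (diagGLUnits u) (latt (!![1, 0, 0; 1, ϖ ^ ρ, 0; 1 * 1 + g, ϖ ^ ρ * 1, ϖ ^ (2 * ρ)] : Matrix (Fin 3) (Fin 3) K))} := by
    ext M
    simp only [Set.mem_setOf_eq, Set.mem_iUnion, hRcut, Finset.coe_filter, Finset.mem_coe, exists_prop]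
    constructor
    · rintro ⟨⟨g, ⟨hgR, hadm⟩, u, hu, rfl⟩, hPM⟩
      exact ⟨g, ⟨hgR, hadm, (hiff g hgR).1 ((hshellinv u hu _).1 hPM)⟩, u, hu, rfl⟩
    · rintro ⟨g, ⟨hgR, hadm, hcut⟩, u, hu, rfl⟩
      exact ⟨⟨g, ⟨hgR, hadm⟩, u, hu, rfl⟩, (hshellinv u hu _).2 ((hiff g hgR).2 hcut)⟩
  have hdisj : (Rcut : Set K).PairwiseDisjoint (fun g : K => {M : Submodule 𝒪[K] (Fin 3 → K) | ∃ u ∈ unitTorus K 3,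
      M = mapGL (diagGLUnits u) (latt (!![1, 0, 0; 1, ϖ ^ ρ, 0; 1 * 1 + g, ϖ ^ ρ * 1, ϖ ^ (2 * ρ)] : Matrix (Fin 3) (Fin 3) K))}) :=
    pairwise_disjoint_orbits_of hϖ ρ (S := (Rcut : Set K)) (R := (R : Set K)) (by rw [hRcut]; exact Finset.coe_subset.2 (Finset.filter_subset _ _))
      (fun g hg => (hR1' g hg).2) (fun g hg => h1g g hg) hR3'
  rw [hset, finsum_mem_biUnion hdisj Rcut.finite_toSet (fun g hg => finite_orbit hϖ hρ (hR1' g (Finset.mem_filter.1 hg).1).2)]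
  -- THE NORM-CLASS SYSTEMS `Aβ`, `Aγ`
  obtain ⟨Aβ, hAβsub, hAβ⟩ := exists_normClass_system hD (n := ρ) (k := 2 * ρ) (M := ρ + d / 2) (by omega) (by omega) (by omega) (by omega) (by omega) (by omega)
  obtain ⟨Aγ, hAγsub, hAγ⟩ := exists_normClass_system hD (n := 2 * ρ) (k := 2 * ρ) (M := ρ + d / 2) (by omega) (by omega) (by omega) (by omega) (by omega) (by omega)
  -- THE SLOT CLASS-FUNCTION AND THE ORBIT VALUES
  set G : K → ℤ := fun r => (![normSign σ (r * (r + gβ / gα)), normSign σ (r + gβ / gα),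
    normSign σ (-1) * normSign σ ((1 + r) * (r + gβ / gα))] : Fin 3 → ℤ) i with hG
  set mass : ℚ := ((((Nat.card 𝓀[K] - 1) * Nat.card 𝓀[K] ^ (ρ - 1)) * ((Nat.card 𝓀[K] - 1) * Nat.card 𝓀[K] ^ (2 * ρ - 1)) : ℕ) : ℚ) *
    ((((Nat.card 𝓀[K] - 1) * Nat.card 𝓀[K] ^ ((ρ + 1) / 2 - 1)) * ((Nat.card 𝓀[K] - 1) * Nat.card 𝓀[K] ^ (ρ - 1)) : ℕ) : ℚ)⁻¹ with hmass
  have hper : ∀ g ∈ (Rcut : Set K),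
      ∑ᶠ M ∈ {M : Submodule 𝒪[K] (Fin 3 → K) | ∃ u ∈ unitTorus K 3,
          M = mapGL (diagGLUnits u) (latt (!![1, 0, 0; 1, ϖ ^ ρ, 0; 1 * 1 + g, ϖ ^ ρ * 1, ϖ ^ (2 * ρ)] : Matrix (Fin 3) (Fin 3) K))},
        (labelledOddCount σ ϖ 0 i (valueClassLabel σ ϖ (α - 1) (β - 1) (mstarOfRecord d) d) M : ℚ) /
          ((((unitStabilizer M).map (unitNormMap σ 3)).relIndex (fixedUnitTorus σ 3) : ℕ) : ℚ) =
        mass / (2 * (Aβ.card : ℚ) * (Aγ.card : ℚ)) * ((Aγ.card : ℚ) * (normSign σ gα : ℚ)) * ((∑ aβ ∈ Aβ, G (g + (1 + g) * (aβ - 1)) : ℤ) : ℚ) := by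
    intro g hg
    have hgR : g ∈ R := (Finset.mem_filter.1 hg).1
    have hcut : Valued.v (g + gβ / gα) = 1 := (Finset.mem_filter.1 hg).2.2
    have hcut' : Valued.v (g + gβ / gα) = Valued.v ϖ ^ 0 := by rw [pow_zero]; exact hcut
    obtain ⟨hσg, hvg⟩ := hR1' g hgR
    have hvg' : Valued.v g = Valued.v ϖ ^ (2 * 0) := by rw [mul_zero, pow_zero]; exact hvg
    have h1g' := h1g g hg
    obtain ⟨hlev, hnlev, hsq⟩ := (hiff g hgR).2 hcut
    rw [← hV₀ g] at hlev hnlev hsq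
    -- stability of the representative
    have hV' : ((V₀ g : GL (Fin 3) K) : Matrix (Fin 3) (Fin 3) K) = !![1, 0, 0; 1, ϖ ^ ρ, 0; 1 * 1 + g, ϖ ^ ρ * 1, ϖ ^ (2 * ρ + 2 * 0)] := by
      rw [mul_zero, add_zero]; exact hV₀ g
    have hTM : mapGL T (latt ((V₀ g : GL (Fin 3) K) : Matrix (Fin 3) (Fin 3) K)) = latt ((V₀ g : GL (Fin 3) K) : Matrix (Fin 3) (Fin 3) K) :=
      mapGL_latt_glued_rep_of_depths hϖ0 hϖ1.le hα1 hβ1 T hT h1n hα h3n (ρ := ρ) (t := 0) (by omega) (by omega) (by omega) hvg' (V₀ g) hV'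
    -- the per-summand identity and the non-vanishing
    have hsgn := fun (aβ : K) (haβ : aβ ∈ Aβ) (aγ : K) (haγ : aγ ∈ Aγ) =>
      classSign_mul_labelSign_eq_unit hD hEρ hdeep hσg hvg h1g' hσgα hσgβ hgα0 hc₀ hcut' (hAβsub aβ haβ).1 (hAβsub aβ haβ).2 (hAγsub aγ haγ).1 (hAγsub aγ haγ).2 i
    have hL : ∀ aβ ∈ Aβ, ∀ aγ ∈ Aγ, g * gα + aγ * (aβ + g⁻¹ * (aβ - 1))⁻¹ * gβ ≠ 0 := fun aβ haβ aγ haγ => (hsgn aβ haβ aγ haγ).1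
    have horb := finsum_orbit_labelledOdd_div_relIndex_coreHanging_rep_eq hD h2 hρ hσg hvg h1g' (V₀ g) (hV₀ g) hE (mc := mcOfRecord d)
      (by omega) (by omega) (by omega) (by omega) hlev hnlev hsq hT hTM hσgα hσgβ hgαT hgβT Aβ Aγ hAγsub hAγ hAβsub hAβ hL i
    have hint : normSign σ ((![((ϖ * σ ϖ) ^ ρ)⁻¹ * g, ((ϖ * σ ϖ) ^ ρ)⁻¹, -(((ϖ * σ ϖ) ^ ρ)⁻¹ * (1 + g)⁻¹)] : Fin 3 → K) i) *
        (∑ aβ ∈ Aβ, ∑ aγ ∈ Aγ, normSign σ ((![(1 : K), aγ * (aβ + g⁻¹ * (aβ - 1))⁻¹, aγ * (aβ + g⁻¹ * (aβ - 1))⁻¹ * aβ] : Fin 3 → K) i) *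
          normSign σ (g * gα + aγ * (aβ + g⁻¹ * (aβ - 1))⁻¹ * gβ)) =
        (Aγ.card : ℤ) * normSign σ gα * ∑ aβ ∈ Aβ, G (g + (1 + g) * (aβ - 1)) := by
      rw [Finset.mul_sum, Finset.mul_sum]
      refine Finset.sum_congr rfl fun aβ haβ => ?_
      rw [Finset.mul_sum, Finset.sum_congr rfl fun aγ haγ => (hsgn aβ haβ aγ haγ).2, Finset.sum_const, nsmul_eq_mul]
      simp only [hG]
      ring
    have hintq : ((normSign σ ((![((ϖ * σ ϖ) ^ ρ)⁻¹ * g, ((ϖ * σ ϖ) ^ ρ)⁻¹, -(((ϖ * σ ϖ) ^ ρ)⁻¹ * (1 + g)⁻¹)] : Fin 3 → K) i) : ℤ) : ℚ) *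
        ((∑ aβ ∈ Aβ, ∑ aγ ∈ Aγ, normSign σ ((![(1 : K), aγ * (aβ + g⁻¹ * (aβ - 1))⁻¹, aγ * (aβ + g⁻¹ * (aβ - 1))⁻¹ * aβ] : Fin 3 → K) i) *
          normSign σ (g * gα + aγ * (aβ + g⁻¹ * (aβ - 1))⁻¹ * gβ) : ℤ) : ℚ) =
        (Aγ.card : ℚ) * (normSign σ gα : ℚ) * ((∑ aβ ∈ Aβ, G (g + (1 + g) * (aβ - 1)) : ℤ) : ℚ) := by
      exact_mod_cast hint
    rw [hmc2.2.2.2, horb, hmass]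
    generalize ((normSign σ ((![((ϖ * σ ϖ) ^ ρ)⁻¹ * g, ((ϖ * σ ϖ) ^ ρ)⁻¹, -(((ϖ * σ ϖ) ^ ρ)⁻¹ * (1 + g)⁻¹)] : Fin 3 → K) i) : ℤ) : ℚ) = ωq at hintq ⊢
    generalize ((∑ aβ ∈ Aβ, ∑ aγ ∈ Aγ, normSign σ ((![(1 : K), aγ * (aβ + g⁻¹ * (aβ - 1))⁻¹, aγ * (aβ + g⁻¹ * (aβ - 1))⁻¹ * aβ] : Fin 3 → K) i) *
          normSign σ (g * gα + aγ * (aβ + g⁻¹ * (aβ - 1))⁻¹ * gβ) : ℤ) : ℚ) = Sq at hintq ⊢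
    generalize ((∑ aβ ∈ Aβ, G (g + (1 + g) * (aβ - 1)) : ℤ) : ℚ) = Gq at hintq ⊢
    generalize ((((Nat.card 𝓀[K] - 1) * Nat.card 𝓀[K] ^ (ρ - 1)) * ((Nat.card 𝓀[K] - 1) * Nat.card 𝓀[K] ^ (2 * ρ - 1)) : ℕ) : ℚ) = M1
    generalize ((((Nat.card 𝓀[K] - 1) * Nat.card 𝓀[K] ^ ((ρ + 1) / 2 - 1)) * ((Nat.card 𝓀[K] - 1) * Nat.card 𝓀[K] ^ (ρ - 1)) : ℕ) : ℚ) = M2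
    calc M1 * M2⁻¹ * (ωq / (2 * (Aβ.card : ℚ) * (Aγ.card : ℚ)) * Sq) = M1 * M2⁻¹ / (2 * (Aβ.card : ℚ) * (Aγ.card : ℚ)) * (ωq * Sq) := by ring
      _ = M1 * M2⁻¹ / (2 * (Aβ.card : ℚ) * (Aγ.card : ℚ)) * ((Aγ.card : ℚ) * (normSign σ gα : ℚ)) * Gq := by rw [hintq]; ring
  rw [finsum_mem_congr rfl hper, finsum_mem_coe_finset, ← Finset.mul_sum, ← Int.cast_sum]
  -- THE LOCUS SUMS VANISH (LH7-p07 (g0), ★ p862310)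
  suffices hzero : ∑ g ∈ Rcut, ∑ aβ ∈ Aβ, G (g + (1 + g) * (aβ - 1)) = 0 by
    rw [hzero, Int.cast_zero, mul_zero]
  have h0 := sum_filter_sum_normSign_mul_add_eq_zero_locus hD h2 h2d (n := ρ) (k := 2 * ρ) (M := ρ + d / 2)
    hρ (by omega) (by omega) (by omega) (by omega) (by omega) (by omega) hσc₀ hc₀ R hR1' hR2' hR3' Aβ hAβsub hAβ
  have h1 := sum_filter_sum_normSign_add_eq_zero_locus hD h2 h2d (n := ρ) (k := 2 * ρ) (M := ρ + d / 2)
    hρ (by omega) (by omega) (by omega) (by omega) (by omega) (by omega) hσc₀ hc₀ R hR1' hR2' hR3' Aβ hAβsub hAβ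
  have h2' := sum_filter_sum_normSign_one_add_mul_add_eq_zero_locus hD h2 h2d (n := ρ) (k := 2 * ρ) (M := ρ + d / 2)
    hρ (by omega) (by omega) (by omega) (by omega) (by omega) (by omega) hσc₀ h1c₀ R hR1' hR2' hR3' Aβ hAβsub hAβ
  rw [hRcut]
  fin_cases i
  · simp only [hG, Fin.zero_eta, Fin.isValue, Matrix.cons_val_zero]
    convert h0 using 2
  · simp only [hG, Fin.mk_one, Fin.isValue, Matrix.cons_val_one, Matrix.cons_val_zero]
    convert h1 using 2
  · simp only [hG, Fin.reduceFinMk, Matrix.cons_val_two, Matrix.tail_cons, Matrix.head_cons]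
    rw [show ∑ g ∈ R.filter (fun g => Valued.v (1 + g) = 1 ∧ Valued.v (g + gβ / gα) = 1), ∑ aβ ∈ Aβ,
        normSign σ (-1) * normSign σ ((1 + (g + (1 + g) * (aβ - 1))) * ((g + (1 + g) * (aβ - 1)) + gβ / gα)) =
      normSign σ (-1) * ∑ g ∈ R.filter (fun g => Valued.v (1 + g) = 1 ∧ Valued.v (g + gβ / gα) = 1), ∑ aβ ∈ Aβ,
        normSign σ ((1 + (g + (1 + g) * (aβ - 1))) * ((g + (1 + g) * (aβ - 1)) + gβ / gα)) by
      rw [Finset.mul_sum]; exact Finset.sum_congr rfl fun _ _ => by rw [Finset.mul_sum]]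
    rw [mul_eq_zero]; right
    convert h2' using 2

end Summit.HodgeConjecture.HodgeConjecture.Cruxes.H413.F0P3cDyRamLabelledOddCoreHangingEquilateralLocus

end
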